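import Literature.AnabelianGeometry.SemiGraphs.SgAToProfiniteBObj
import Literature.AnabelianGeometry.SemiGraphs.SgAFiniteEtaleStabilizers
import Literature.AnabelianGeometry.SemiGraphs.TemperedReconstruction
import HarnessLib

/-!
# [SemiAnbd] Def. 2.2 (i) on the profinite presentation: the vertices / edges of a finite étale covering
# are the orbits of the attached finite object of `B^cov` (bridge brick L1b, proof-only)

Mochizuki, *Semi-graphs of anabelioids*, Publ. RIMS **42** (2006), Def. 2.2 (i) p. 23: "the vertices
(respectively, edges) of `𝔾'` that lie over a vertex `v` (respectively, an edge `e`) correspond to the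
connected components of `S_v` (respectively, `T_e`)"; Def. 3.5 (i) p. 37: the covering attached to an
object of `B^cov(𝒢)` (whose vertices over `v` are the `Π_v`-orbits, abc-iut-L3-t2's `coveringSemiGraph`)
(kurims `paper:url-f33ace170ff4`). [cite: MochizukiSemiAnbd2006, Def. 2.2(i) p.23]

PROOF-ONLY brick L1b of the (R1) bridge (HOME/staging/L3/L3-t3/R1-BRIDGE-SHAPES.md §4; interface owner
abc-iut-L3-t3), over B6 `SgAToProfiniteBObj.lean` (`BObj.toCovObj A`) and L1a
`SgAFiniteEtaleStabilizers.lean`: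

* `Anabelioids.exists_orbitOfComponent_bijective` — for a Galois category `C`, a fibre functor `F` and
  an object `X`, the connected components of `X` (`π₀Obj X`) are in canonical bijection with the
  `Aut F`-orbits of `F(X)` (each component `P ↪ X` goes to the orbit `F(P) ⊆ F(X)`;
  `ComponentsOrbits.lean`), read in abc-iut-L3-t2's orbit type `BTemp.Orbits` of the finite
  `Π_v`-set;
* `HomOver.exists_vertex_bijection_of_isFiniteEtaleCoveringOf` (+ edges) — for
  `φ.toHom.IsFiniteEtaleCoveringOf A`, THE VERTICES OF THE COVERING `𝒢` ARE IN BIJECTION, OVER THE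
  VERTICES OF `ℋ`, WITH THE VERTICES `Σ v, Orbits(F_v(S_v))` OF THE COVERING GRAPH OF `BObj.toCovObj A`,
  and the vertex homomorphism of the profinite reading at `w` is injective with image the stabiliser of
  a point of the orbit `w` goes to (L1a) — the vertex/edge half, WITH the group dictionary, of the
  `IsoOver` wanted by law L1; the branch/abutment compatibility (needing the alignment clauses of
  `IsFiniteEtaleCoveringGlobal`) remains.

Nothing of the paper is asserted; no side taken on [IUTchIII] Cor. 3.12.
-/

noncomputable section

namespace Literature.AnabelianGeometry.Anabelioids

open CategoryTheory CategoryTheory.Limits CategoryTheory.PreGaloisCategory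
open Literature.AnabelianGeometry.SemiGraphs

universe u

section Orbits

variable {C : Type u} [Category.{u} C] [GaloisCategory C] (F : C ⥤ FintypeCat.{u}) [FiberFunctor F]

/-- **Components ↔ orbits, as a bijection into abc-iut-L3-t2's orbit type**: for `X ∈ C` and the finite
`Aut F`-set `F(X)` read in `B^temp(Aut F)` (`toBTemp ∘ functorToContAction`), there is a bijection
`π₀Obj X → Orbits` sending a connected component `P ↪ X` to the orbit `F(P) ⊆ F(X)`: for every `P`
and every `y ∈ F(P)` the class of `F(P ↪ X)(y)` is the image of `P`.
[cite: MochizukiSemiAnbd2006, Def. 2.2(i) p.23] -/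
theorem exists_orbitOfComponent_bijective (X : C) :
    ∃ Ψ : π₀Obj X → BTemp.Orbits ((toBTemp (Aut F)).obj ((functorToContAction F).obj X)),
      Function.Bijective Ψ ∧
        ∀ (P : π₀Obj X) (y : F.obj X), y ∈ Set.range (F.map P.1.arrow) →
          Ψ P = BTemp.cl ((toBTemp (Aut F)).obj ((functorToContAction F).obj X)) y := by
  classical
  let S : BTemp (Aut F) := (toBTemp (Aut F)).obj ((functorToContAction F).obj X)
  -- the relation defining `Orbits S` is the `Aut F`-orbit relation on `F(X)`
  have hcl : ∀ y y' : F.obj X, BTemp.cl S y = BTemp.cl S y' ↔ y' ∈ MulAction.orbit (Aut F) y := by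
    intro y y'
    rw [BTemp.cl_eq_cl_iff, MulAction.mem_orbit_iff]
    exact Iff.rfl
  -- a point in the fibre of each component
  have hpt : ∀ P : π₀Obj X, ∃ y : F.obj X, y ∈ Set.range (F.map P.1.arrow) := fun P => by
    haveI : IsConnected (P.1 : C) := P.2
    obtain ⟨p⟩ := nonempty_fiber_of_isConnected F (P.1 : C)
    exact ⟨F.map P.1.arrow p, p, rfl⟩
  choose pt hpt using hpt
  refine ⟨fun P => BTemp.cl S (pt P), ⟨fun P Q hPQ => ?_, fun ω => ?_⟩, fun P y hy => ?_⟩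
  · -- injective: equal orbits ⇒ the chosen points lie in both fibre-images ⇒ same component
    have h1 : pt Q ∈ MulAction.orbit (Aut F) (pt P) := (hcl _ _).mp hPQ
    rw [← range_map_arrow_eq_orbit F P (hpt P)] at h1
    exact component_eq_of_mem_range F P Q h1 (hpt Q)
  · -- surjective: every point lies in the fibre-image of some component
    induction ω using Quot.ind with
    | _ x =>
      obtain ⟨P, hP⟩ := exists_component_mem_range F x
      refine ⟨P, (hcl _ _).mpr ?_⟩
      rw [← range_map_arrow_eq_orbit F P (hpt P)]
      exact hP
  · rw [hcl, ← range_map_arrow_eq_orbit F P (hpt P)]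
    exact hy

end Orbits

end Literature.AnabelianGeometry.Anabelioids

namespace Literature.AnabelianGeometry.SemiGraphs

open CategoryTheory CategoryTheory.Limits CategoryTheory.PreGaloisCategory
open Literature.AnabelianGeometry.Anabelioids

universe u

namespace SemiGraphOfAnabelioids.HomOver

variable {𝒢 ℋ : SemiGraphOfAnabelioids.{u, u, u}} {f : 𝒢.graph ⟶ ℋ.graph} (φ : HomOver 𝒢 ℋ f)

/-- The vertex fibre of `BObj.toCovObj A` over `v`, as an object of `B^temp(Π_v)`, is `F_v(S_v)` read in
`B^temp` (definitional bookkeeping for B6's `toCovObj = ofBObjObj ∘ compare`).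
[cite: MochizukiSemiAnbd2006, Def 3.5(i) p.37] -/
theorem toCovObj_SV_eq (A : ℋ.BObj) (v : ℋ.graph.Vertex) :
    (BObj.toCovObj A).SV v = (toBTemp (Aut (ℋ.fibV v))).obj ((functorToContAction (ℋ.fibV v)).obj (A.S v)) :=
  rfl

/-- The edge fibre of `BObj.toCovObj A` over `e` is `F_e(T_e)` read in `B^temp`.
[cite: MochizukiSemiAnbd2006, Def 3.5(i) p.37] -/
theorem toCovObj_SE_eq (A : ℋ.BObj) (e : ℋ.graph.Edge) :
    (BObj.toCovObj A).SE e = (toBTemp (Aut (ℋ.fibE e))).obj ((functorToContAction (ℋ.fibE e)).obj (A.T e)) :=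
  rfl

/-- **Def. 2.2 (i) / Def. 3.5 (i): the vertices of a finite étale covering are the orbits of the
attached finite object of `B^cov`, compatibly with the stabiliser dictionary.**  For
`φ.toHom.IsFiniteEtaleCoveringOf A` there is a BIJECTION `Φ` from the vertices of `𝒢` onto the vertices
`Σ v, Orbits(F_v(S_v))` of the covering graph of `BObj.toCovObj A` (B6), lying over `f` on vertices, such
that for every vertex `w` the vertex homomorphism `Π_{𝒢,w} → Π_{ℋ,f w}` of the profinite reading (B2)
is injective with image the stabiliser of a point `y` whose orbit is `Φ w` (L1a).
[cite: MochizukiSemiAnbd2006, Def. 2.2(i) p.23] -/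
theorem exists_vertex_bijection_of_isFiniteEtaleCoveringOf {A : ℋ.BObj}
    (hφ : φ.toHom.IsFiniteEtaleCoveringOf A) :
    ∃ Φ : 𝒢.graph.Vertex → (BObj.toCovObj A).coveringSemiGraph.Vertex,
      Function.Bijective Φ ∧ (∀ w, (Φ w).1 = f.vertexMap w) ∧
        ∀ w, Function.Injective (φ.hVProfinite w) ∧
          ∃ y : (ℋ.fibV (f.vertexMap w)).obj (A.S (f.vertexMap w)),
            Φ w = ⟨f.vertexMap w, BTemp.cl ((BObj.toCovObj A).SV (f.vertexMap w)) y⟩ ∧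
              (φ.hVProfinite w).toMonoidHom.range =
                MulAction.stabilizer (Aut (ℋ.fibV (f.vertexMap w))) y := by
  classical
  rcases hφ with ⟨-, cV, cE, hbijV, -, hV, -, -⟩
  change ∀ v', π₀Obj (A.S (f.vertexMap v')) at cV
  change Function.Bijective (fun v' : 𝒢.graph.Vertex =>
    (⟨f.vertexMap v', cV v'⟩ : Σ v, π₀Obj (A.S v))) at hbijV
  -- components ↔ orbits at every vertex of `ℋ`
  have hΨ := fun v : ℋ.graph.Vertex => exists_orbitOfComponent_bijective (ℋ.fibV v) (A.S v)
  choose Ψ hΨbij hΨcl using hΨ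
  refine ⟨fun w => ⟨f.vertexMap w, Ψ (f.vertexMap w) (cV w)⟩, ?_, fun w => rfl, fun w => ?_⟩
  · -- bijective: the two bijections `w ↦ (f w, cV w)` and `P ↦ orbit of P`, fibrewise
    have aux₁ : ∀ (v v' : ℋ.graph.Vertex) (P : π₀Obj (A.S v)) (P' : π₀Obj (A.S v')),
        (⟨v, Ψ v P⟩ : (BObj.toCovObj A).coveringSemiGraph.Vertex) = ⟨v', Ψ v' P'⟩ →
          (⟨v, P⟩ : Σ v, π₀Obj (A.S v)) = ⟨v', P'⟩ := by
      intro v v' P P' h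
      obtain ⟨rfl, h2⟩ := Sigma.mk.inj_iff.mp h
      rw [(hΨbij v).1 (eq_of_heq h2)]
    have aux₂ : ∀ (v v' : ℋ.graph.Vertex) (P : π₀Obj (A.S v)) (P' : π₀Obj (A.S v')),
        (⟨v, P⟩ : Σ v, π₀Obj (A.S v)) = ⟨v', P'⟩ →
          (⟨v, Ψ v P⟩ : (BObj.toCovObj A).coveringSemiGraph.Vertex) = ⟨v', Ψ v' P'⟩ := by
      intro v v' P P' h
      cases h
      rfl
    refine ⟨fun w w' hww => hbijV.1 (aux₁ _ _ _ _ hww), fun x => ?_⟩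
    obtain ⟨v, ω⟩ := x
    obtain ⟨P, hP⟩ := (hΨbij v).2 ω
    obtain ⟨w, hw⟩ := hbijV.2 ⟨v, P⟩
    refine ⟨w, ?_⟩
    change (⟨f.vertexMap w, Ψ (f.vertexMap w) (cV w)⟩ :
        (BObj.toCovObj A).coveringSemiGraph.Vertex) = ⟨v, ω⟩
    rw [aux₂ _ _ _ _ hw, hP]
  · -- the stabiliser dictionary (L1a) at a point of the fibre-image of the component `cV w`
    obtain ⟨α, hα, hne⟩ := hV w
    obtain ⟨e⟩ := hne
    have hmono : Mono (cV w).1.arrow := inferInstance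
    obtain ⟨hinj, -⟩ :=
      @hVOfPath_injective_and_exists_range_eq_stabilizer _ _ _ φ w _ α hα e (φ.vertexPath w)
    obtain ⟨y, hy, hrange⟩ :=
      @hVOfPath_exists_range_eq_stabilizer_of_mono _ _ _ φ w _ _ (cV w).1.arrow hmono α hα e
        (φ.vertexPath w)
    refine ⟨hinj, y, ?_, hrange⟩
    change (⟨f.vertexMap w, Ψ (f.vertexMap w) (cV w)⟩ :
        (BObj.toCovObj A).coveringSemiGraph.Vertex) = _
    rw [hΨcl (f.vertexMap w) (cV w) y hy]
    rfl

/-- **The edge analogue**: the edges of the covering `𝒢` are in bijection, over the edges of `ℋ`, with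
the edges `Σ e, Orbits(F_e(T_e))` of the covering graph of `BObj.toCovObj A`, compatibly with the
stabiliser dictionary of the edge homomorphisms. [cite: MochizukiSemiAnbd2006, Def. 2.2(i) p.23] -/
theorem exists_edge_bijection_of_isFiniteEtaleCoveringOf {A : ℋ.BObj}
    (hφ : φ.toHom.IsFiniteEtaleCoveringOf A) :
    ∃ Φ : 𝒢.graph.Edge → (BObj.toCovObj A).coveringSemiGraph.Edge,
      Function.Bijective Φ ∧ (∀ e₀, (Φ e₀).1 = f.edgeMap e₀) ∧
        ∀ e₀, Function.Injective (φ.hEAt e₀ (f.edgeMap e₀) rfl) ∧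
          ∃ y : (ℋ.fibE (f.edgeMap e₀)).obj (A.T (f.edgeMap e₀)),
            Φ e₀ = ⟨f.edgeMap e₀, BTemp.cl ((BObj.toCovObj A).SE (f.edgeMap e₀)) y⟩ ∧
              (φ.hEAt e₀ (f.edgeMap e₀) rfl).toMonoidHom.range =
                MulAction.stabilizer (Aut (ℋ.fibE (f.edgeMap e₀))) y := by
  classical
  rcases hφ with ⟨-, cV, cE, -, hbijE, -, hE, -⟩
  change ∀ e', π₀Obj (A.T (f.edgeMap e')) at cE
  change Function.Bijective (fun e' : 𝒢.graph.Edge =>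
    (⟨f.edgeMap e', cE e'⟩ : Σ e, π₀Obj (A.T e))) at hbijE
  have hΨ := fun e : ℋ.graph.Edge => exists_orbitOfComponent_bijective (ℋ.fibE e) (A.T e)
  choose Ψ hΨbij hΨcl using hΨ
  refine ⟨fun e₀ => ⟨f.edgeMap e₀, Ψ (f.edgeMap e₀) (cE e₀)⟩, ?_, fun e₀ => rfl, fun e₀ => ?_⟩
  · have aux₁ : ∀ (e e' : ℋ.graph.Edge) (P : π₀Obj (A.T e)) (P' : π₀Obj (A.T e')),
        (⟨e, Ψ e P⟩ : (BObj.toCovObj A).coveringSemiGraph.Edge) = ⟨e', Ψ e' P'⟩ →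
          (⟨e, P⟩ : Σ e, π₀Obj (A.T e)) = ⟨e', P'⟩ := by
      intro e e' P P' h
      obtain ⟨rfl, h2⟩ := Sigma.mk.inj_iff.mp h
      rw [(hΨbij e).1 (eq_of_heq h2)]
    have aux₂ : ∀ (e e' : ℋ.graph.Edge) (P : π₀Obj (A.T e)) (P' : π₀Obj (A.T e')),
        (⟨e, P⟩ : Σ e, π₀Obj (A.T e)) = ⟨e', P'⟩ →
          (⟨e, Ψ e P⟩ : (BObj.toCovObj A).coveringSemiGraph.Edge) = ⟨e', Ψ e' P'⟩ := by
      intro e e' P P' h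
      cases h
      rfl
    refine ⟨fun a b hab => hbijE.1 (aux₁ _ _ _ _ hab), fun x => ?_⟩
    obtain ⟨e, ω⟩ := x
    obtain ⟨P, hP⟩ := (hΨbij e).2 ω
    obtain ⟨e₀, he₀⟩ := hbijE.2 ⟨e, P⟩
    refine ⟨e₀, ?_⟩
    change (⟨f.edgeMap e₀, Ψ (f.edgeMap e₀) (cE e₀)⟩ :
        (BObj.toCovObj A).coveringSemiGraph.Edge) = ⟨e, ω⟩
    rw [aux₂ _ _ _ _ he₀, hP]
  · obtain ⟨α, hα, hne⟩ := hE e₀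
    obtain ⟨e⟩ := hne
    have hmono : Mono (cE e₀).1.arrow := inferInstance
    obtain ⟨hinj, -⟩ :=
      @hEOfPath_injective_and_exists_range_eq_stabilizer _ _ _ φ e₀ (f.edgeMap e₀) rfl _ α hα e
        (φ.edgePath e₀ (f.edgeMap e₀) rfl)
    obtain ⟨y, hy, hrange⟩ :=
      @hEOfPath_exists_range_eq_stabilizer_of_mono _ _ _ φ e₀ (f.edgeMap e₀) rfl _ _ (cE e₀).1.arrow
        hmono α hα e (φ.edgePath e₀ (f.edgeMap e₀) rfl)
    refine ⟨hinj, y, ?_, hrange⟩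
    change (⟨f.edgeMap e₀, Ψ (f.edgeMap e₀) (cE e₀)⟩ :
        (BObj.toCovObj A).coveringSemiGraph.Edge) = _
    rw [hΨcl (f.edgeMap e₀) (cE e₀) y hy]
    rfl

end SemiGraphOfAnabelioids.HomOver

end Literature.AnabelianGeometry.SemiGraphs

end
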